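import Summits.CriticalPhenomena.PercolationContinuityZ3.Theorems.Transplant.ThetaDropBoxProdZ2
import HarnessLib

/-!
# `SamePWitnessAt'` — the same-`p` witness WITHOUT an envelope bound (design (D)'s scheme has finite but unbounded envelopes), its Peierls
# consequences `θ_x(p) > 0` / `p_c ≤ p`, and the drop-node packaging of the typed top (`bsConj4_boxProdZ2_of_dropNode`)

builds on p205010 (kernel theorem, internal audit signed; external expert review pending).
Status sentence (coordinator 2026-08-20T04:30Z): "θ(p_c) = 0 on ℤ^d, all d ≥ 2 — kernel-verified (Lean 4/Mathlib, standard axioms); internal adversarial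
audit SIGNED 2026-08-20 04:29Z; external expert review pending."
Lane `prim-bschramm-*`, seat `prim-bschramm-stmt` (gen 4); lead (g2) RULING V56 (13:23Z), order (S1): *"`SamePWitnessAt′` (no N) next to
BoxProdZ2Defs' `SamePWitnessAt` + `theta_criticalProb_eq_zero_of_witness′` via `theta_pos_of_lawful`, the DROP NODE … and the typed top re-pointed
through `SameP.theta_criticalProb_eq_zero_of_drop`: `continuity_boxProdZ2_of_drop`, `bsConj4_boxProdZ2_of_dropNode`"* (the drop node and
`continuity_boxProdZ2_of_drop` are `Transplant/ThetaDropBoxProdZ2.lean`, p219373).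
* `SameP.SamePWitnessAt' G x p` (DEFINITION, reviewed): a history-driven site-renormalisation scheme on `G`, lawful at `(p, ε)` with `ε < 2⁻³²`,
  `U₀ ⊆ E(G)`, whose infinite final macro-cluster forces `x ↔ ∞` up to the null set `{ω ⊄ E(G)}` — i.e. BoxProdZ2Defs' `SamePWitnessAt` with the
  clause "probe envelopes of at most `N` edges" DELETED.  Design (D) (concentric regions with index-growing radii, ENTRY-SEED-STAR.md §10) produces
  exactly this at the running density: envelopes are finite for every history but not uniformly bounded, so neither `SamePWitnessAt`'s `N` nor
  Theorem A's `hN` (`criticalProb_lt_of_lawful`) is available — and neither is needed for the Peierls half.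
* `samePWitnessAt'_of_samePWitnessAt` (forget `N`); **`theta_pos_of_witness'`**: `0 < p → SamePWitnessAt' G x p → 0 < θ_x(p)` (the lead's
  `theta_pos_of_lawful`, p218990 — Peierls half of Theorem A, no envelope bound); `criticalProb_le_of_witness'`: `… → p_c(G,x) ≤ p`;
  `theta_criticalProb_eq_zero_of_witness'`: if `θ_x(p_c) > 0` forces a primed witness at some positive `q < p_c`, then `θ_x(p_c) = 0`
  (drop form at the single density `p_c`, via `theta_criticalProbIOf_eq_zero_of_drop_at`).
* **`exists_drop_of_witness'_below`**: `(∃ q, 0 < q ∧ q < p ∧ SamePWitnessAt' G x q) → ∃ q, q < p ∧ 0 < θ_x(q)` — the form in which design (D)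
  discharges the drop node `ThetaDropBoxProdZ2` (run the construction at `q₀ < p`, get a primed witness at `q₀`);
  `thetaDropBoxProdZ2_of_witness'_below` — the drop node from "a primed witness at some smaller positive density" for product graphs.
* **`bsConj4_boxProdZ2_of_dropNode`** — the typed top through the lead's all-densities drop principle `SameP.theta_criticalProb_eq_zero_of_drop`:
  if for every infinite connected locally finite quasi-transitive AMENABLE `X` and every `w`, `p`, `θ_{(w,0)}(p) > 0 ⇒ ∃ q < p, θ_{(w,0)}(q) > 0`
  on `X □ ℤ²`, then `BSConj4_boxProdZ2` (non-amenable case: Hutchcroft, `bsConj4_boxProdZ2_of_amenable_case`).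
[cite: KozmaNitzan2024, §1 p. 2 (approach 1), §4 p. 25 (Definition of an exploration process)] [cite: BenjaminiSchramm1996, Conj. 4] [cite: Hutchcroft2016, Thm. 1]
-/

noncomputable section

namespace Summit.CriticalPhenomena.PercolationContinuityZ3.Theorems

open MeasureTheory Literature.Probability.Percolation Literature.Probability.LatticeModels
open Literature.Barriers.CriticalPhenomena (IsQuasiTransitive IsGraphAmenable countable_of_connected_of_locallyFinite)

namespace SameP

variable {V : Type}

/-! ## The primed witness (no envelope bound) -/

/-- **The same-`p` witness without an envelope bound**: a history-driven site-renormalisation scheme on `G`, lawful at `(p, ε)` with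
`ε < 2⁻³²`, `U₀ ⊆ E(G)`, whose infinite final macro-cluster forces `x ↔ ∞` up to the null set `{ω ⊄ E(G)}` (`SamePWitnessAt` minus the clause
`∀ h P, S.E.next h = some P → P.env.card ≤ N`).  What design (D)'s concentric scheme delivers at its running density.
[cite: KozmaNitzan2024, §4 p. 25 (Definition of an exploration process)] -/
def SamePWitnessAt' (G : SimpleGraph V) (x : V) (p : unitInterval) : Prop :=
  ∃ (S : HSiteScheme V) (ε : ℝ), S.Lawful G p ε ∧ ε < (1 / 2) ^ 32 ∧ (↑S.U₀ : Set (Sym2 V)) ⊆ G.edgeSet ∧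
    S.initEvent ∩ {ω | (S.occFinal ω).Infinite} ⊆ percolatesAt x ∪ {ω | ¬ω ⊆ G.edgeSet}

/-- Forgetting the envelope bound: `SamePWitnessAt → SamePWitnessAt'`. [folklore] -/
theorem samePWitnessAt'_of_samePWitnessAt (G : SimpleGraph V) (x : V) (p : unitInterval) (h : SamePWitnessAt G x p) :
    SamePWitnessAt' G x p := by
  obtain ⟨S, ε, _N, hL, hε, _hN, hU, hperc⟩ := h
  exact ⟨S, ε, hL, hε, hU, hperc⟩

/-- **Peierls half of Theorem A for the primed witness**: `0 < p` and `SamePWitnessAt' G x p` give `θ_x(p) > 0` (lead's `theta_pos_of_lawful`;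
no envelope bound is used). [cite: KozmaNitzan2024, §4 Thm. 6 (Peierls step, p. 25)] -/
theorem theta_pos_of_witness' [Countable V] (G : SimpleGraph V) (x : V) {p : unitInterval} (hp : 0 < (p : ℝ)) (h : SamePWitnessAt' G x p) :
    0 < theta G x p := by
  obtain ⟨S, ε, hL, hε, hU, hperc⟩ := h
  exact theta_pos_of_lawful hL hε.le hU hp hperc

/-- `p_c(G, x) ≤ p` from a primed witness at `p > 0`. [cite: KozmaNitzan2024, §1 p. 2 (approach 1)] -/
theorem criticalProb_le_of_witness' [Countable V] (G : SimpleGraph V) (x : V) {p : unitInterval} (hp : 0 < (p : ℝ))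
    (h : SamePWitnessAt' G x p) : criticalProb G x ≤ p :=
  OrbitQuotient.criticalProb_le_of_theta_pos G x p (theta_pos_of_witness' G x hp h)

/-- **The drop from a primed witness below `p`**: a primed witness at some positive density `q < p` gives `θ_x(q) > 0` for that `q < p`.
(The form in which design (D) discharges the drop node: run the construction at `q₀ < p`.) [cite: KozmaNitzan2024, §1 p. 2 (approach 1)] -/
theorem exists_drop_of_witness'_below [Countable V] (G : SimpleGraph V) (x : V) {p : unitInterval}
    (h : ∃ q : unitInterval, 0 < (q : ℝ) ∧ (q : ℝ) < p ∧ SamePWitnessAt' G x q) :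
    ∃ q : unitInterval, (q : ℝ) < p ∧ 0 < theta G x q := by
  obtain ⟨q, hq0, hqp, hW⟩ := h
  exact ⟨q, hqp, theta_pos_of_witness' G x hq0 hW⟩

/-- **`θ_x(p_c) = 0` from a primed witness below `p_c`**: if `θ_x(p_c) > 0` forces a primed witness at some positive density `q < p_c`, then
`θ_x(p_c) = 0` (drop at the single density `p_c`, `theta_criticalProbIOf_eq_zero_of_drop_at`). [cite: KozmaNitzan2024, §1 p. 2 (approach 1)] -/
theorem theta_criticalProb_eq_zero_of_witness' [Countable V] (G : SimpleGraph V) (x : V)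
    (h : 0 < theta G x (criticalProbIOf G x) →
      ∃ q : unitInterval, 0 < (q : ℝ) ∧ (q : ℝ) < criticalProb G x ∧ SamePWitnessAt' G x q) :
    theta G x (criticalProbIOf G x) = 0 :=
  theta_criticalProbIOf_eq_zero_of_drop_at G x fun hθ => exists_drop_of_witness'_below G x (p := criticalProbIOf G x) (h hθ)

end SameP

namespace Transplant

/-! ## The drop node from primed witnesses below `p`; the typed top from an all-densities drop -/

/-- **The drop node from primed witnesses at smaller densities** (design (D)'s deliverable shape): if under the node's hypotheses at `p` the
concentric construction yields a primed witness `SamePWitnessAt'` on `X □ ℤ²` at some positive `q < p`, then `ThetaDropBoxProdZ2`.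
[cite: KozmaNitzan2024, §1 p. 2 (approach 1), §4 pp. 15–25] -/
theorem thetaDropBoxProdZ2_of_witness'_below
    (h : ∀ {W : Type} [DecidableEq W] (X : SimpleGraph W) [X.LocallyFinite], X.Connected → IsQuasiTransitive X → IsGraphAmenable X →
      Infinite W → ∀ (w : W) (p : unitInterval),
        (∀ᵐ ω ∂(bondPercolation (X □ zdGraph 2) p), numInfiniteClusters ω ≤ 1) → BoxProdZ2.TubeSubcritical X p →
          0 < theta (X □ zdGraph 2) (w, (0 : Site 2)) p →
            ∃ q : unitInterval, 0 < (q : ℝ) ∧ (q : ℝ) < p ∧ SameP.SamePWitnessAt' (X □ zdGraph 2) (w, (0 : Site 2)) q) :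
    ThetaDropBoxProdZ2 := by
  intro W _ X _ hc hq ha hinf w p hU hT hθ
  haveI : Countable (W × Site 2) := countable_of_connected_of_locallyFinite (X □ zdGraph 2) (connected_boxProd_zdGraph hc 2) (w, 0)
  exact SameP.exists_drop_of_witness'_below (X □ zdGraph 2) (w, 0) (h X hc hq ha hinf w p hU hT hθ)

/-- **The typed top through an all-densities drop** (lead's `SameP.theta_criticalProb_eq_zero_of_drop`): if for every infinite, connected,
locally finite, quasi-transitive, AMENABLE `X`, every `w` and every density `p`, `θ_{(w,0)}(p) > 0` on `X □ ℤ²` forces `θ_{(w,0)}(q) > 0` for some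
`q < p`, then `BSConj4_boxProdZ2` (the non-amenable case is Hutchcroft's, `bsConj4_boxProdZ2_of_amenable_case`) — builds on p205010 (kernel
theorem, internal audit signed; external expert review pending). [cite: KozmaNitzan2024, §1 p. 2 (approach 1)] [cite: BenjaminiSchramm1996, Conj. 4] [cite: Hutchcroft2016, Thm. 1] -/
theorem bsConj4_boxProdZ2_of_dropNode
    (h : ∀ {W : Type} [DecidableEq W] (X : SimpleGraph W) [X.LocallyFinite], X.Connected → IsQuasiTransitive X → Infinite W →
      IsGraphAmenable X → ∀ (w : W) (p : unitInterval), 0 < theta (X □ zdGraph 2) (w, (0 : Site 2)) p →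
        ∃ q : unitInterval, (q : ℝ) < p ∧ 0 < theta (X □ zdGraph 2) (w, (0 : Site 2)) q) :
    BSConj4_boxProdZ2 := by
  refine bsConj4_boxProdZ2_of_amenable_case fun {W} _ X _ hc hq hinf ha w => ?_
  haveI : Countable (W × Site 2) := countable_of_connected_of_locallyFinite (X □ zdGraph 2) (connected_boxProd_zdGraph hc 2) (w, 0)
  exact SameP.theta_criticalProb_eq_zero_of_drop (X □ zdGraph 2) (w, 0) (h X hc hq hinf ha w)

end Transplant

end Summit.CriticalPhenomena.PercolationContinuityZ3.Theorems

end
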